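import Summits.HodgeConjecture.HodgeCM.PerL34.LocTorusSplitBase_1

/-! PORT of `HodgeCM/PerL34/LocTorusSplitBase.lean` (HodgeCMPerL run 82) — part 2: continuation of `Summits.HodgeConjecture.HodgeCM.PerL34.LocTorusSplitBase_1` (split at a top-level declaration boundary by port_pkg.py; scope re-opened below; declarations unchanged). -/

-- port_pkg: scope re-opened for this part (file-level context, then the namespace/section stack open at the cut)
set_option autoImplicit false
noncomputable section
open Topology Filter Set Sum IsDedekindDomain NumberField
open Literature.NumberTheory Literature.NumberTheory.Automorphic
open scoped RestrictedProduct Classical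
namespace HodgeCM.PerL34.IdelicTorusModel
open IdelePlaces RestrictedRegroup RestrictedCutout
variable {K L : Type} [Field K] [Field L] [Algebra K L] [NumberField K] [NumberField L]
attribute [local instance] liesOver_under isMaximal_asIdeal
section equivBase
variable (σ : L ≃ₐ[K] L) [IsGalois K L] (h2 : ∀ τ : L ≃ₐ[K] L, τ = 1 ∨ τ = σ) {w : HeightOneSpectrum (𝓞 L)}
  (hw : σ • w ≠ w)
include h2 hw
/-- `ι` is a homeomorphism. -/
theorem isHomeomorph_baseMap : IsHomeomorph (baseMap K w) :=
  isHomeomorph_iff_isEmbedding_surjective.2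
    ⟨(isClosedEmbedding_baseMap σ h2 hw).isEmbedding, baseMap_surjective σ h2 hw⟩

/-- **`K_v ≃ₜ L_w`** at a split place. -/
def baseHomeomorph : (w.under (𝓞 K)).adicCompletion K ≃ₜ w.adicCompletion L :=
  (isHomeomorph_baseMap σ h2 hw).homeomorph (baseMap K w)

/-- (Ported verbatim from the HodgeCMPerL package; no docstring in the source.) -/
@[simp] theorem baseHomeomorph_apply (y : (w.under (𝓞 K)).adicCompletion K) :
    baseHomeomorph σ h2 hw y = baseMap K w y := rfl

/-- (Ported verbatim from the HodgeCMPerL package; no docstring in the source.) -/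
theorem continuous_baseEquiv : Continuous (baseEquiv σ h2 hw) := continuous_baseMap w

/-- (Ported verbatim from the HodgeCMPerL package; no docstring in the source.) -/
theorem baseEquiv_symm_eq_baseHomeomorph_symm :
    ⇑(baseEquiv σ h2 hw).symm = (baseHomeomorph σ h2 hw).symm := by
  funext z
  apply (baseEquiv σ h2 hw).injective
  rw [RingEquiv.apply_symm_apply, baseEquiv_apply, ← baseHomeomorph_apply σ h2 hw, Homeomorph.apply_symm_apply]

/-- (Ported verbatim from the HodgeCMPerL package; no docstring in the source.) -/
theorem continuous_baseEquiv_symm : Continuous (baseEquiv σ h2 hw).symm := by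
  rw [baseEquiv_symm_eq_baseHomeomorph_symm]
  exact (baseHomeomorph σ h2 hw).symm.continuous

/-- (Ported verbatim from the HodgeCMPerL package; no docstring in the source.) -/
theorem valued_baseEquiv (y : (w.under (𝓞 K)).adicCompletion K) : Valued.v (baseEquiv σ h2 hw y) = Valued.v y :=
  valued_baseMap σ h2 hw y

/-- (Ported verbatim from the HodgeCMPerL package; no docstring in the source.) -/
theorem norm_baseEquiv (y : (w.under (𝓞 K)).adicCompletion K) : ‖baseEquiv σ h2 hw y‖ = ‖y‖ :=
  norm_baseMap σ h2 hw y

/-- (Ported verbatim from the HodgeCMPerL package; no docstring in the source.) -/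
theorem valued_baseEquiv_symm (z : w.adicCompletion L) : Valued.v ((baseEquiv σ h2 hw).symm z) = Valued.v z := by
  conv_rhs => rw [← (baseEquiv σ h2 hw).apply_symm_apply z]
  exact (valued_baseEquiv σ h2 hw _).symm

/-- (Ported verbatim from the HodgeCMPerL package; no docstring in the source.) -/
theorem norm_baseEquiv_symm (z : w.adicCompletion L) : ‖(baseEquiv σ h2 hw).symm z‖ = ‖z‖ := by
  conv_rhs => rw [← (baseEquiv σ h2 hw).apply_symm_apply z]
  exact (norm_baseEquiv σ h2 hw _).symm

/-- **`K_vˣ ≃ₜ* L_wˣ`** at a split place. -/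
def unitsBaseEquiv : ((w.under (𝓞 K)).adicCompletion K)ˣ ≃ₜ* (w.adicCompletion L)ˣ where
  toMulEquiv := Units.mapEquiv (baseEquiv σ h2 hw).toMulEquiv
  continuous_toFun := Continuous.units_map (baseEquiv σ h2 hw).toMulEquiv.toMonoidHom (continuous_baseEquiv σ h2 hw)
  continuous_invFun :=
    Continuous.units_map (baseEquiv σ h2 hw).symm.toMulEquiv.toMonoidHom (continuous_baseEquiv_symm σ h2 hw)

/-- (Ported verbatim from the HodgeCMPerL package; no docstring in the source.) -/
@[simp] theorem coe_unitsBaseEquiv (y : ((w.under (𝓞 K)).adicCompletion K)ˣ) :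
    ((unitsBaseEquiv σ h2 hw y : (w.adicCompletion L)ˣ) : w.adicCompletion L) = baseMap K w (y : _) := rfl

/-- (Ported verbatim from the HodgeCMPerL package; no docstring in the source.) -/
@[simp] theorem coe_unitsBaseEquiv_symm (z : (w.adicCompletion L)ˣ) :
    (((unitsBaseEquiv σ h2 hw).symm z : ((w.under (𝓞 K)).adicCompletion K)ˣ) : (w.under (𝓞 K)).adicCompletion K) =
      (baseEquiv σ h2 hw).symm (z : _) := rfl

variable {v : HeightOneSpectrum (𝓞 K)} (hwv : w.under (𝓞 K) = v)

/-- **`U_v ≃ₜ* K_vˣ` at a split place** — PerL v5 tex l. 610 "`U(W_i)(L_{0,v})` … is `L_{0,v}^×`" (`L_0` = our `K`)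
inside the genuine adelic torus: `z ↦ ι⁻¹(z_w)` (`splitEquiv` followed by `K_v = L_w`). -/
def splitEquivBase : locTorus K L (inr v) ≃ₜ* (v.adicCompletion K)ˣ := by
  subst hwv
  exact (splitEquiv σ rfl h2 hw).trans (unitsBaseEquiv σ h2 hw).symm

/-- (Ported verbatim from the HodgeCMPerL package; no docstring in the source.) -/
theorem splitEquivBase_def :
    splitEquivBase σ h2 hw (w := w) rfl = (splitEquiv σ rfl h2 hw).trans (unitsBaseEquiv σ h2 hw).symm := rfl

/-- `‖splitEquivBase g‖ = ‖g_w‖`. -/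
theorem norm_splitEquivBase (g : locTorus K L (inr (w.under (𝓞 K)))) :
    ‖((splitEquivBase σ h2 hw rfl g : ((w.under (𝓞 K)).adicCompletion K)ˣ) : (w.under (𝓞 K)).adicCompletion K)‖ =
      ‖((splitEquiv σ rfl h2 hw g : (w.adicCompletion L)ˣ) : w.adicCompletion L)‖ :=
  norm_baseEquiv_symm σ h2 hw _

/-- `v(splitEquivBase g) = v(g_w)`. -/
theorem valued_splitEquivBase (g : locTorus K L (inr (w.under (𝓞 K)))) :
    Valued.v (((splitEquivBase σ h2 hw rfl g : ((w.under (𝓞 K)).adicCompletion K)ˣ) :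
      (w.under (𝓞 K)).adicCompletion K)) =
      Valued.v (((splitEquiv σ rfl h2 hw g : (w.adicCompletion L)ˣ) : w.adicCompletion L)) :=
  valued_baseEquiv_symm σ h2 hw _

/-- **The level at a split place is `𝒪_vˣ`**: `g ∈ (Π_{u∣v} 𝒪_uˣ) ⊓ U_v ↔ v(splitEquivBase g) = 1`. -/
theorem mem_inH_iff_valued_splitEquivBase_eq_one (g : locTorus K L (inr (w.under (𝓞 K)))) :
    g ∈ inH (fun k => fibSubgroup (intUnits L) (pl K L) k) (locTorus K L) (inr (w.under (𝓞 K))) ↔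
      Valued.v (((splitEquivBase σ h2 hw rfl g : ((w.under (𝓞 K)).adicCompletion K)ˣ) :
        (w.under (𝓞 K)).adicCompletion K)) = 1 := by
  rw [valued_splitEquivBase, mem_inH_iff_valued_eq_one_of_split σ rfl h2 hw]

/-- The level at a split place as `‖splitEquivBase g‖ = 1` (pv13-g3's END shape `hτUB`, now over `K_v`). -/
theorem mem_inH_iff_norm_splitEquivBase_eq_one (g : locTorus K L (inr (w.under (𝓞 K)))) :
    g ∈ inH (fun k => fibSubgroup (intUnits L) (pl K L) k) (locTorus K L) (inr (w.under (𝓞 K))) ↔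
      ‖((splitEquivBase σ h2 hw rfl g : ((w.under (𝓞 K)).adicCompletion K)ˣ) : (w.under (𝓞 K)).adicCompletion K)‖
        = 1 := by
  rw [norm_splitEquivBase, mem_inH_iff_norm_eq_one_of_split σ rfl h2 hw]

/-- The level corresponds to `𝒪_vˣ := {y ∈ K_vˣ | v(y) = 1}` under `splitEquivBase` (image description). -/
theorem valued_eq_one_iff_of_mem_range (y : ((w.under (𝓞 K)).adicCompletion K)ˣ) :
    Valued.v (y : (w.under (𝓞 K)).adicCompletion K) = 1 ↔
      (splitEquivBase σ h2 hw rfl).symm y ∈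
        inH (fun k => fibSubgroup (intUnits L) (pl K L) k) (locTorus K L) (inr (w.under (𝓞 K))) := by
  rw [mem_inH_iff_valued_splitEquivBase_eq_one σ h2 hw, ContinuousMulEquiv.apply_symm_apply]

end equivBase

/-! ## §5  CM specialisation: `K = L⁺`, `σ = c` -/

section CM

variable [IsCMField L] {w : HeightOneSpectrum (𝓞 L)}

/-- For a CM field `L` and a finite place `w` of `L` not fixed by complex conjugation (`v := w ∩ L⁺` split in
`L`): **`U_v ≃ₜ* (L⁺_v)ˣ`**. -/
def splitEquivBaseCM (hw : IsCMField.complexConj L • w ≠ w) {v : HeightOneSpectrum (𝓞 (maximalRealSubfield L))}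
    (hwv : w.under (𝓞 (maximalRealSubfield L)) = v) :
    locTorus (maximalRealSubfield L) L (inr v) ≃ₜ* (v.adicCompletion (maximalRealSubfield L))ˣ :=
  splitEquivBase (IsCMField.complexConj L) (eq_one_or_eq_complexConj (L := L)) hw hwv

/-- CM form of `K_v ≃+* L_w` at a place not fixed by `c`. -/
def baseEquivCM (hw : IsCMField.complexConj L • w ≠ w) :
    (w.under (𝓞 (maximalRealSubfield L))).adicCompletion (maximalRealSubfield L) ≃+* w.adicCompletion L :=
  baseEquiv (IsCMField.complexConj L) (eq_one_or_eq_complexConj (L := L)) hw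

end CM

end HodgeCM.PerL34.IdelicTorusModel

-- port_pkg: scope closed for this part
end
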